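/-
Copyright (c) 2026 the pub-hodgecm-mathlib formalisation cell (harness21).  Prover seat hodgecm-mathlib-A-p19 (g24) — (U) road, U4-DISCHARGE (W2), explicit-constant chain link (closer), 2026-09-01.
-/
import Literature.NumberTheory.Rogawski1990.ArchLimitFormulaNoncompactWallProof      -- ★ p840819 the ∃-closer: brings every lemma its proof uses ((d1)(d2′)(d3a)(d3a-II), Bruhat cut-off, WLOG, (V4), (V9))
import Literature.NumberTheory.Automorphic.ArchLocalWallAveragingExplicit            -- ★ p844841 (d3a) with the witness exposed; scalar `1` for the product centraliser measure
import HarnessLib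

/-!
# The (J-nc) clause for a WALL-BLOCK PRODUCT centraliser measure with its constant EXPOSED: `c = μ₁(univ) · C(μ₂)`, `C(μ₂)` = the rank-one (R1G) constant of the `G₂`-block measure
# ((U) road, U4-DISCHARGE (W2) = CENSUS-Jval (b2), MEMO-U4-NC-v1 (n4)+(n5); Rogawski 1990 §8.2 p. 119∕p. 123, Varadarajan 1989 §6.4 Thm 22)

Topic `NumberTheory/Rogawski1990`; namespace `Literature.NumberTheory.Rogawski1990`.  ONE THEOREM (no `def`, no instance, no notation, no axiom, no named fact, no `sorry`).
Cell `pub/hodgecm-mathlib`, crux H413 = `stmt-HodgeConjecture-24833` (supports only).  Count-neutral.  HONEST LABEL: HC_CM is proved only modulo the 2 remaining named inputs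
(hLiu418, h413) until rung 0 closes; this file pays nothing by itself.

WHAT.  ★ p840819 `archLimitFormulaNoncompactWall_holds` proves the letter (J-nc) with `∃ c ≠ 0`, `c = c₀ · C`: `c₀` from ★ (d3a) (∃), `C` from ★ (R1G) (∃, depends on the Haar measure
chosen on the `G₂`-block).  U4's (nc) conjunct (★ p844462; owner junction ★ p844761 `archTopFormWallCompatible_of_massEqSource_of_clause`) needs the clause for the SPECIFIC centraliser
measure `θ_w(β) = ι_*(μ₂ ⊗ μ₁)` (the wall-block product; `μ₂`, `μ₁` the top-form block measures) with the SPECIFIC constant `−V₂·V₁`.  This file re-runs the ★ closer token for token with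
three changes: the block measures `μ₂`, `μ₁` are PARAMETERS (not `haar`), the centraliser measure is `νH = ι_*(μ₂ ⊗ μ₁)` (hypothesis `hνH`, U4's `θ` text verbatim), and the rank-one
limit formula for `μ₂` enters as a HYPOTHESIS `hR` with a named constant `C` (★ (R1G)'s conclusion body at `E = ℂ`); then ★ p844841 gives `c₀ = haarScalarFactor νH ((μ₂ × μ₁).map e⁻¹) ·
μ₁(univ) = μ₁(univ)` and the clause holds with **`c = μ₁(univ) · C`**:
* **`archLimitFormulaNoncompactWall_clause_wallBlockMap … (μ₂ μ₁) (νH) (hνH) (C) (hR) : ‹(J-nc) clause for (ν, z₁, νH) with constant ((μ₁ univ).toReal * C : ℝ)›`**.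
CONSEQUENCE FOR (W2): with `μ₂ := archLocalTopFormHaar L 2 (diagonal(β₀,β₂)) w`, `μ₁ := archLocalTopFormHaar L 1 (diagonal β₁) w` (so `μ₁(univ) = V₁`), U4's (nc) constant `−V₂·V₁`
is EQUIVALENT to «the (R1G) constant of the top-form Haar measure of the indefinite `U(σ_w diag(β₀,β₂))(ℂ)` is `−V₂ = −vol^TF(U(2))`» — the rank-one identity of MEMO-U4-NC-v1 §0
(`C = −π·C_disc(μ₂^TF)`, `C_disc^TF = π²∕2`, `V₂ = π³∕2`), bricks (n2)(n3) + an explicit (R1G) transport.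

## References
* [Rogawski1990] J. D. Rogawski, *Automorphic Representations of Unitary Groups in Three Variables*, Ann. of Math. Stud. 123 (1990), §8.2 p. 119, p. 123.
* [Varadarajan1989] V. S. Varadarajan, *An Introduction to Harmonic Analysis on Semisimple Lie Groups* (1989), §6.4 Thm 22, Lemma 21.
* [Folland1995] G. B. Folland, *A Course in Abstract Harmonic Analysis* (1995), §2.6.
-/

set_option autoImplicit false

noncomputable section

open MeasureTheory Measure Filter Topology NumberField NumberField.InfinitePlace Set
open Literature.MeasureTheory.Group Literature.NumberTheory.Automorphic Literature.NumberTheory.Automorphic.UnitaryGroup Literature.Analysis.Calculus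
open scoped Matrix MatrixGroups Matrix.Norms.Operator Pointwise NNReal

namespace Literature.NumberTheory.Rogawski1990

variable (L : Type) [Field L] [NumberField L] [IsCMField L] (α : Fin 3 → L) (w : {w : InfinitePlace L // IsComplex w})

set_option maxHeartbeats 1600000 in
/-- **THE (J-nc) CLAUSE FOR THE WALL-BLOCK PRODUCT MEASURE, EXPLICIT CONSTANT `μ₁(univ) · C(μ₂)`.**  At a noncompact `{0,2}`-wall of the circle torus of `G_w = U(σ_w diag α)(ℂ)` (CM `L`,
`α` real non-zero, `re σα₀ · re σα₂ < 0`), for Haar block measures `μ₂` on `U(σ_w diag(α₀,α₂))(ℂ)`, `μ₁` on `U(σ_w α₁)(ℂ)`, the centraliser measure `νH = ι_*(μ₂ ⊗ μ₁)` and a right-invariant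
Haar `ν`: IF the rank-one limit formula holds for `μ₂` with constant `C` (`hR`, ★ (R1G)'s shape), THEN `lim_{ψ→0,ψ≠0} ∂_ψ[2 sin ψ · ∫_G Θ(g t_w(z_ψ) g⁻¹) dν] = (μ₁(univ)·C) · ∫_{G⧸Z} descConj Θ d(ν∕νH)`
for all smooth compactly supported `Θ` and wall points `z₀`.  Proof = ★ p840819 token for token over ★ p844841. [cite: Rogawski1990, §8.2 p. 119, p. 123] [cite: Varadarajan1989, §6.4 Thm 22, Lemma 21] -/
theorem archLimitFormulaNoncompactWall_clause_wallBlockMap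
    [MeasurableSpace (GL (Fin 3) ℂ)] [BorelSpace (GL (Fin 3) ℂ)] [MeasurableSpace (GL (Fin 2) ℂ)] [BorelSpace (GL (Fin 2) ℂ)]
    [MeasurableSpace (GL (Fin 1) ℂ)] [BorelSpace (GL (Fin 1) ℂ)]
    (hα : ∀ i, α i ≠ 0) (hreal : ∀ i, (w.1.embedding (α i)).im = 0)
    (ν : Measure (archLocal L 3 (Matrix.diagonal α) w)) [ν.IsHaarMeasure] [ν.IsMulRightInvariant]
    (z₁ : Fin 3 → Circle) (h02 : z₁ 0 = z₁ 2) (h01 : z₁ 0 ≠ z₁ 1)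
    (μ₂ : Measure ↥(unitaryGroupOfForm (starRingEnd ℂ) ((Matrix.diagonal ![α 0, α 2]).map w.1.embedding))) [μ₂.IsHaarMeasure]
    (μ₁ : Measure ↥(unitaryGroupOfForm (starRingEnd ℂ) ((Matrix.diagonal ![α 1]).map w.1.embedding))) [μ₁.IsHaarMeasure]
    (νH : Measure (Subgroup.centralizer ({(⟨circleDiagonal 3 z₁, circleDiagonal_mem_archLocal_diagonal L 3 α w z₁⟩ : archLocal L 3 (Matrix.diagonal α) w)} : Set (archLocal L 3 (Matrix.diagonal α) w)))) [νH.IsHaarMeasure] [νH.IsInvInvariant]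
    (hνH : νH = (Measure.map (fun p : ↥(unitaryGroupOfForm (starRingEnd ℂ) ((Matrix.diagonal ![α 0, α 2]).map w.1.embedding)) × ↥(unitaryGroupOfForm (starRingEnd ℂ) ((Matrix.diagonal ![α 1]).map w.1.embedding)) =>
            (⟨endoEmb (starRingEnd ℂ) ((Matrix.diagonal ![α 0, α 2]).map w.1.embedding) ((Matrix.diagonal ![α 1]).map w.1.embedding)
                ((Matrix.diagonal α).map w.1.embedding) (endoForm_archLocal_diagonal L α w) p,
              endoEmb_mem_centralizer_circleDiagonal L α w h02 p⟩ : ↥(Subgroup.centralizer ({(⟨circleDiagonal 3 z₁, circleDiagonal_mem_archLocal_diagonal L 3 α w z₁⟩ : archLocal L 3 (Matrix.diagonal α) w)} : Set (archLocal L 3 (Matrix.diagonal α) w)))))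
          ((μ₂).prod (μ₁))))
    [MeasurableSpace (archLocal L 3 (Matrix.diagonal α) w ⧸ Subgroup.centralizer ({(⟨circleDiagonal 3 z₁, circleDiagonal_mem_archLocal_diagonal L 3 α w z₁⟩ : archLocal L 3 (Matrix.diagonal α) w)} : Set (archLocal L 3 (Matrix.diagonal α) w)))] [BorelSpace (archLocal L 3 (Matrix.diagonal α) w ⧸ Subgroup.centralizer ({(⟨circleDiagonal 3 z₁, circleDiagonal_mem_archLocal_diagonal L 3 α w z₁⟩ : archLocal L 3 (Matrix.diagonal α) w)} : Set (archLocal L 3 (Matrix.diagonal α) w)))]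
    (C : ℝ)
    (hR : ∀ (f : Matrix (Fin 2) (Fin 2) ℂ → ℂ), ContDiff ℝ 1 f → HasCompactSupport f → ∀ z : Circle,
        Tendsto (fun ψ : ℝ => deriv (fun ψ : ℝ => (2 * Real.sin ψ) •
            ∫ h : ↥(unitaryGroupOfForm (starRingEnd ℂ) ((Matrix.diagonal ![α 0, α 2]).map w.1.embedding)), f (((h * ⟨circleDiagonal 2 ![z * Circle.exp ψ, z * Circle.exp (-ψ)], circleDiagonal_mem_archLocal_diagonal L 2 ![α 0, α 2] w _⟩ * h⁻¹ : ↥(unitaryGroupOfForm (starRingEnd ℂ) ((Matrix.diagonal ![α 0, α 2]).map w.1.embedding))) :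
              GL (Fin 2) ℂ) : Matrix (Fin 2) (Fin 2) ℂ) ∂μ₂) ψ)
          (𝓝[≠] 0) (𝓝 (C • f ((z : ℂ) • (1 : Matrix (Fin 2) (Fin 2) ℂ)))) ∧
        ∀ ψ ∈ Ioo (-1 : ℝ) 1, ψ ≠ 0 → DifferentiableAt ℝ (fun ψ : ℝ => (2 * Real.sin ψ) •
            ∫ h : ↥(unitaryGroupOfForm (starRingEnd ℂ) ((Matrix.diagonal ![α 0, α 2]).map w.1.embedding)), f (((h * ⟨circleDiagonal 2 ![z * Circle.exp ψ, z * Circle.exp (-ψ)], circleDiagonal_mem_archLocal_diagonal L 2 ![α 0, α 2] w _⟩ * h⁻¹ : ↥(unitaryGroupOfForm (starRingEnd ℂ) ((Matrix.diagonal ![α 0, α 2]).map w.1.embedding))) :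
              GL (Fin 2) ℂ) : Matrix (Fin 2) (Fin 2) ℂ) ∂μ₂) ψ) :
    haveI : LocallyCompactSpace (archLocal L 3 (Matrix.diagonal α) w) := locallyCompactSpace_archLocal L 3 (Matrix.diagonal α) w
    haveI : SecondCountableTopology (archLocal L 3 (Matrix.diagonal α) w) := secondCountableTopology_archLocal L 3 (Matrix.diagonal α) w
    ∀ (Θ : Matrix (Fin 3) (Fin 3) ℂ → ℂ), ContDiff ℝ (⊤ : ℕ∞) Θ →
            HasCompactSupport (fun k : archLocal L 3 (Matrix.diagonal α) w => Θ ((k : GL (Fin 3) ℂ) : Matrix (Fin 3) (Fin 3) ℂ)) →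
            ∀ (z₀ : Fin 3 → Circle) (h02' : z₀ 0 = z₀ 2) (h01' : z₀ 0 ≠ z₀ 1),
              Tendsto (fun ψ : ℝ => deriv (fun ψ : ℝ => (2 * Real.sin ψ : ℂ) *
                  ∫ g, Θ (((g * ⟨circleDiagonal 3 (fun i => z₀ i * Circle.exp (![(1 : ℝ), 0, -1] i * ψ)),
                    circleDiagonal_mem_archLocal_diagonal L 3 α w _⟩ * g⁻¹ : archLocal L 3 (Matrix.diagonal α) w) : GL (Fin 3) ℂ) : Matrix (Fin 3) (Fin 3) ℂ) ∂(ν)) ψ)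
                (𝓝[≠] 0)
                (𝓝 ((((μ₁ Set.univ).toReal * C : ℝ) : ℂ) * ∫ y, descConj (⟨circleDiagonal 3 z₀, circleDiagonal_mem_archLocal_diagonal L 3 α w z₀⟩ : archLocal L 3 (Matrix.diagonal α) w)
                  (Subgroup.centralizer ({(⟨circleDiagonal 3 z₁, circleDiagonal_mem_archLocal_diagonal L 3 α w z₁⟩ : archLocal L 3 (Matrix.diagonal α) w)} : Set (archLocal L 3 (Matrix.diagonal α) w)))
                  (forall_mem_centralizer_circleDiagonal_comm_of_wall L α w h02 h01 h02' h01')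
                  (fun k : archLocal L 3 (Matrix.diagonal α) w => Θ ((k : GL (Fin 3) ℂ) : Matrix (Fin 3) (Fin 3) ℂ)) y
                  ∂(quotientMeasure _ (νH) (isClosed_coe_centralizer_singleton _) (ν)))) := by
  classical
  haveI := locallyCompactSpace_archLocal L 3 (Matrix.diagonal α) w
  haveI := secondCountableTopology_archLocal L 3 (Matrix.diagonal α) w
  -- topology and Haar measures on the block groups `G₂`, `G₁`
  haveI : LocallyCompactSpace (unitaryGroupOfForm (starRingEnd ℂ) ((Matrix.diagonal ![α 0, α 2]).map w.1.embedding)) := locallyCompactSpace_archLocal L 2 (Matrix.diagonal ![α 0, α 2]) w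
  haveI : SecondCountableTopology (unitaryGroupOfForm (starRingEnd ℂ) ((Matrix.diagonal ![α 0, α 2]).map w.1.embedding)) := secondCountableTopology_archLocal L 2 (Matrix.diagonal ![α 0, α 2]) w
  haveI : LocallyCompactSpace (unitaryGroupOfForm (starRingEnd ℂ) ((Matrix.diagonal ![α 1]).map w.1.embedding)) := locallyCompactSpace_archLocal L 1 (Matrix.diagonal ![α 1]) w
  haveI : SecondCountableTopology (unitaryGroupOfForm (starRingEnd ℂ) ((Matrix.diagonal ![α 1]).map w.1.embedding)) := secondCountableTopology_archLocal L 1 (Matrix.diagonal ![α 1]) w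
  -- hermitian-diagonal from the letter's reality hypothesis
  have hherm : ∀ i, (IsCMField.complexConj L (α i) : L) = α i := fun i => by
    apply w.1.embedding.injective
    rw [NumberField.IsCMField.complexEmbedding_complexConj, Complex.conj_eq_iff_im, hreal i]
  have hZ : IsClosed ((Subgroup.centralizer ({(⟨circleDiagonal 3 z₁, circleDiagonal_mem_archLocal_diagonal L 3 α w z₁⟩ : archLocal L 3 (Matrix.diagonal α) w)} : Set (archLocal L 3 (Matrix.diagonal α) w))) : Set (archLocal L 3 (Matrix.diagonal α) w)) := isClosed_coe_centralizer_singleton _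
  -- `H_w ≃ₜ* G₂ × G₁` (★ (V9))
  obtain ⟨e, he⟩ : ∃ e : ↥(Subgroup.centralizer ({(⟨circleDiagonal 3 z₁, circleDiagonal_mem_archLocal_diagonal L 3 α w z₁⟩ : archLocal L 3 (Matrix.diagonal α) w)} : Set (archLocal L 3 (Matrix.diagonal α) w))) ≃ₜ* (↥(unitaryGroupOfForm (starRingEnd ℂ) ((Matrix.diagonal ![α 0, α 2]).map w.1.embedding)) × ↥(unitaryGroupOfForm (starRingEnd ℂ) ((Matrix.diagonal ![α 1]).map w.1.embedding))),
      ∀ p, ((e.symm p : ↥(Subgroup.centralizer ({(⟨circleDiagonal 3 z₁, circleDiagonal_mem_archLocal_diagonal L 3 α w z₁⟩ : archLocal L 3 (Matrix.diagonal α) w)} : Set (archLocal L 3 (Matrix.diagonal α) w)))) : archLocal L 3 (Matrix.diagonal α) w) =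
        endoEmb (starRingEnd ℂ) ((Matrix.diagonal ![α 0, α 2]).map w.1.embedding) ((Matrix.diagonal ![α 1]).map w.1.embedding)
          ((Matrix.diagonal α).map w.1.embedding) (endoForm_archLocal_diagonal L α w) p :=
    exists_centralizer_continuousMulEquiv_of_splitSingular L α w h02 h01
  -- the regular-side constant `c₀` (★ (d3a)) and the rank-one constant `C` (★ (R1G))
  -- the regular-side constant, EXPLICIT (★ `integral_comp_conj_circleDiagonal_eq_haarScalarFactor_mul_integral_averaged`): `haarScalarFactor νH ((μ₂ × μ₁).map e⁻¹) · μ₁(univ)`,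
  -- and the scalar is `1` because `νH` IS `(μ₂ × μ₁).map e⁻¹`
  haveI : ((μ₂.prod μ₁).map e.symm).IsHaarMeasure := ContinuousMulEquiv.isHaarMeasure_map (μ₂.prod μ₁) e.symm
  have hB := integral_comp_conj_circleDiagonal_eq_haarScalarFactor_mul_integral_averaged L α w hα hreal e he νH μ₂ μ₁ ν
  have hθe : νH = (μ₂.prod μ₁).map e.symm := by
    rw [hνH]
    congr 1
    funext p
    exact Subtype.ext (he p).symm
  have hHSF : haarScalarFactor νH ((μ₂.prod μ₁).map e.symm) = 1 := haarScalarFactor_map_symm_prod_self L α w e μ₂ μ₁ νH hθe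
  simp only [hHSF, NNReal.coe_one, one_mul] at hB
  set c₀ : ℝ := (μ₁ Set.univ).toReal with hc₀_def
  intro Θ hΘ hΘs z₀ h02' h01'
  -- WLOG `Θ` has AMBIENT compact support (★ p840156): both sides only read `Θ ∘ ↑↑`
  have hcoe : Continuous fun k : archLocal L 3 (Matrix.diagonal α) w => ((k : GL (Fin 3) ℂ) : Matrix (Fin 3) (Fin 3) ℂ) := Units.continuous_val.comp continuous_subtype_val
  obtain ⟨Θ', hΘ', hΘ's, -, hagree⟩ := exists_contDiff_hasCompactSupport_comp_eq (ι := fun k : archLocal L 3 (Matrix.diagonal α) w => ((k : GL (Fin 3) ℂ) : Matrix (Fin 3) (Fin 3) ℂ)) hcoe hΘ hΘs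
  have hagree' : ∀ k : archLocal L 3 (Matrix.diagonal α) w, Θ ((k : GL (Fin 3) ℂ) : Matrix (Fin 3) (Fin 3) ℂ) = Θ' ((k : GL (Fin 3) ℂ) : Matrix (Fin 3) (Fin 3) ℂ) := fun k => (hagree k).symm
  simp_rw [hagree']
  have hΘ'c : Continuous Θ' := hΘ'.continuous
  have hΘ'1 : ContDiff ℝ 1 Θ' := hΘ'.of_le (by exact_mod_cast le_top)
  have hΘ'k : HasCompactSupport fun k : archLocal L 3 (Matrix.diagonal α) w => Θ' ((k : GL (Fin 3) ℂ) : Matrix (Fin 3) (Fin 3) ℂ) := by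
    have h : (fun k : archLocal L 3 (Matrix.diagonal α) w => Θ' ((k : GL (Fin 3) ℂ) : Matrix (Fin 3) (Fin 3) ℂ)) = fun k : archLocal L 3 (Matrix.diagonal α) w => Θ ((k : GL (Fin 3) ℂ) : Matrix (Fin 3) (Fin 3) ℂ) := funext fun k => (hagree' k).symm
    rw [h]; exact hΘs
  -- the curve near the wall point: a `δ₁` with `z₀ 0 · e^{iψ} ≠ z₀ 1` for `|ψ| < δ₁`
  have hne0 : (fun ψ : ℝ => z₀ 0 * Circle.exp ψ) 0 ≠ z₀ 1 := by simpa [Circle.exp_zero] using h01'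
  obtain ⟨δ₁, hδ₁, hδ₁ne⟩ : ∃ δ₁ > 0, ∀ ψ : ℝ, |ψ| < δ₁ → z₀ 0 * Circle.exp ψ ≠ z₀ 1 := by
    have hopen : IsOpen {ψ : ℝ | z₀ 0 * Circle.exp ψ ≠ z₀ 1} :=
      isOpen_ne_fun (continuous_const.mul Circle.exp.continuous) continuous_const
    obtain ⟨δ₁, hδ₁, hball⟩ := Metric.isOpen_iff.mp hopen 0 hne0
    exact ⟨δ₁, hδ₁, fun ψ hψ => hball (by simpa [Real.dist_eq] using hψ)⟩
  -- the compact set of torus parameters `K = z([−δ, δ])`, `δ = min (δ₁∕2) (1∕2)`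
  obtain ⟨δ, hδdef⟩ : ∃ δ : ℝ, δ = min (δ₁ / 2) (1 / 2) := ⟨_, rfl⟩
  have hδ : 0 < δ := by rw [hδdef]; exact lt_min (by linarith) (by norm_num)
  have hδ₁' : ∀ ψ : ℝ, |ψ| ≤ δ → |ψ| < δ₁ := fun ψ hψ => by
    have : δ ≤ δ₁ / 2 := by rw [hδdef]; exact min_le_left _ _
    linarith
  have hδ1 : ∀ ψ : ℝ, |ψ| < δ → |ψ| < 1 := fun ψ hψ => by
    have : δ ≤ 1 / 2 := by rw [hδdef]; exact min_le_right _ _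
    linarith
  have hz0 : ∀ ψ : ℝ, (fun i => z₀ i * Circle.exp (![(1 : ℝ), 0, -1] i * ψ)) 0 = z₀ 0 * Circle.exp ψ := fun ψ => by simp
  have hz1 : ∀ ψ : ℝ, (fun i => z₀ i * Circle.exp (![(1 : ℝ), 0, -1] i * ψ)) 1 = z₀ 1 := fun ψ => by simp [Circle.exp_zero]
  have hz2 : ∀ ψ : ℝ, (fun i => z₀ i * Circle.exp (![(1 : ℝ), 0, -1] i * ψ)) 2 = z₀ 0 * Circle.exp (-ψ) := fun ψ => by simp [h02']
  have hsep : ∀ ψ : ℝ, |ψ| < δ₁ → (fun i => z₀ i * Circle.exp (![(1 : ℝ), 0, -1] i * ψ)) 1 ≠ (fun i => z₀ i * Circle.exp (![(1 : ℝ), 0, -1] i * ψ)) 0 ∧ (fun i => z₀ i * Circle.exp (![(1 : ℝ), 0, -1] i * ψ)) 1 ≠ (fun i => z₀ i * Circle.exp (![(1 : ℝ), 0, -1] i * ψ)) 2 := fun ψ hψ => by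
    refine ⟨?_, ?_⟩
    · rw [hz1, hz0]; exact (hδ₁ne ψ hψ).symm
    · rw [hz1, hz2]; exact (hδ₁ne (-ψ) (by simpa using hψ)).symm
  have hreg : ∀ ψ : ℝ, ψ ≠ 0 → |ψ| < δ → ∀ i j : Fin 3, i ≠ j → (fun i => z₀ i * Circle.exp (![(1 : ℝ), 0, -1] i * ψ)) i ≠ (fun i => z₀ i * Circle.exp (![(1 : ℝ), 0, -1] i * ψ)) j := by
    intro ψ hψ0 hψ
    have h01ψ := (hsep ψ ((hδ₁' ψ hψ.le))).1
    have h12ψ := (hsep ψ ((hδ₁' ψ hψ.le))).2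
    have h02ψ : (fun i => z₀ i * Circle.exp (![(1 : ℝ), 0, -1] i * ψ)) 0 ≠ (fun i => z₀ i * Circle.exp (![(1 : ℝ), 0, -1] i * ψ)) 2 := by
      rw [hz0, hz2]
      intro h
      have h' : Circle.exp ψ = Circle.exp (-ψ) := mul_left_cancel h
      obtain ⟨m, hm⟩ := Circle.exp_eq_exp.mp h'
      have hψ1 : |ψ| < 1 := hδ1 ψ hψ
      have hm0 : (m : ℝ) = 0 ∨ (1 : ℝ) ≤ |(m : ℝ)| := by
        rcases eq_or_ne m 0 with h0 | h0
        · left; simp [h0]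
        · right; exact_mod_cast Int.one_le_abs h0
      rcases hm0 with hm0 | hm1
      · rw [hm0, zero_mul, add_zero] at hm; exact hψ0 (by linarith)
      · have : (2 : ℝ) * ψ = m * (2 * Real.pi) := by linarith
        have h2 : |(2 : ℝ) * ψ| = |(m : ℝ)| * (2 * Real.pi) := by
          rw [this, abs_mul, abs_of_pos (by positivity : (0 : ℝ) < 2 * Real.pi)]
        have h3 : |(2 : ℝ) * ψ| < 2 := by rw [abs_mul, abs_two]; linarith
        nlinarith [Real.pi_gt_three, abs_nonneg (m : ℝ)]
    intro i j hij
    fin_cases i <;> fin_cases j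
    all_goals first | exact absurd rfl hij | exact h01ψ.symm | exact h01ψ | exact h12ψ | exact h12ψ.symm | exact h02ψ | exact h02ψ.symm
  -- (d1): ONE compact `S ⊆ G_w ⧸ H_w` carrying the conjugates into `supp Θ` of every `t_w z`, `z ∈ K`
  have hKc : IsCompact ((fun ψ : ℝ => (fun i => z₀ i * Circle.exp (![(1 : ℝ), 0, -1] i * ψ))) '' Metric.closedBall (0 : ℝ) δ) :=
    (isCompact_closedBall (0 : ℝ) δ).image (continuous_torusCurve z₀ ![(1 : ℝ), 0, -1])
  have hKsep : (fun ψ : ℝ => (fun i => z₀ i * Circle.exp (![(1 : ℝ), 0, -1] i * ψ))) '' Metric.closedBall (0 : ℝ) δ ⊆ {z | z 1 ≠ z 0 ∧ z 1 ≠ z 2} := by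
    rintro _ ⟨ψ, hψ, rfl⟩
    have hψ' : |ψ| ≤ δ := by simpa [Real.dist_eq] using hψ
    exact hsep ψ (hδ₁' ψ hψ')
  obtain ⟨S, hS, hSmem⟩ := exists_isCompact_forall_mk_mem_of_conj_mem_wall L α w hα hherm h02 h01 hKc hKsep hΘ'k.isCompact
  -- the local Bruhat cut-off over `S` (★ p840607)
  obtain ⟨β, hβ, hβs, -, -, hβ1⟩ := exists_hasCompactSupport_integral_mul_fiber_eq_one (Subgroup.centralizer ({(⟨circleDiagonal 3 z₁, circleDiagonal_mem_archLocal_diagonal L 3 α w z₁⟩ : archLocal L 3 (Matrix.diagonal α) w)} : Set (archLocal L 3 (Matrix.diagonal α) w))) νH hZ hS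
  have h1 : ∀ ψ : ℝ, |ψ| ≤ δ → ∀ g : archLocal L 3 (Matrix.diagonal α) w, Θ' (((g * ⟨circleDiagonal 3 (fun i => z₀ i * Circle.exp (![(1 : ℝ), 0, -1] i * ψ)), circleDiagonal_mem_archLocal_diagonal L 3 α w _⟩ * g⁻¹ : archLocal L 3 (Matrix.diagonal α) w) : GL (Fin 3) ℂ) : Matrix (Fin 3) (Fin 3) ℂ) ≠ 0 →
      ∫ h : Subgroup.centralizer ({(⟨circleDiagonal 3 z₁, circleDiagonal_mem_archLocal_diagonal L 3 α w z₁⟩ : archLocal L 3 (Matrix.diagonal α) w)} : Set (archLocal L 3 (Matrix.diagonal α) w)), β (g * h) ∂νH = 1 := fun ψ hψ g hg =>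
    hβ1 g (hSmem g _ ⟨ψ, by simpa [Real.dist_eq] using hψ, rfl⟩ (subset_tsupport (fun k : archLocal L 3 (Matrix.diagonal α) w => Θ' ((k : GL (Fin 3) ℂ) : Matrix (Fin 3) (Fin 3) ℂ)) hg))
  -- the averaged test function `f♭` and its regularity (★ (d3a-II))
  have hf : ContDiff ℝ 1 (fun X : Matrix (Fin 2) (Fin 2) ℂ => ∫ g, (β g : ℂ) * Θ' (((g : GL (Fin 3) ℂ) : Matrix (Fin 3) (Fin 3) ℂ) * endoForm X ((circleDiagonal 1 ![z₀ 1] : GL (Fin 1) ℂ) : Matrix (Fin 1) (Fin 1) ℂ) * (((g : GL (Fin 3) ℂ)⁻¹ : GL (Fin 3) ℂ) : Matrix (Fin 3) (Fin 3) ℂ)) ∂ν) :=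
    contDiff_one_averagedTestFunction L α w ν β hβ hβs Θ' hΘ'1 _
  have hfs : HasCompactSupport (fun X : Matrix (Fin 2) (Fin 2) ℂ => ∫ g, (β g : ℂ) * Θ' (((g : GL (Fin 3) ℂ) : Matrix (Fin 3) (Fin 3) ℂ) * endoForm X ((circleDiagonal 1 ![z₀ 1] : GL (Fin 1) ℂ) : Matrix (Fin 1) (Fin 1) ℂ) * (((g : GL (Fin 3) ℂ)⁻¹ : GL (Fin 3) ℂ) : Matrix (Fin 3) (Fin 3) ℂ)) ∂ν) :=
    hasCompactSupport_averagedTestFunction L α w ν β hβs Θ' hΘ's _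
  -- (R1G) for `f♭` at `z = z₀ 0`
  obtain ⟨hlim, hdiff⟩ := hR _ hf hfs (z₀ 0)
  -- the torus elements along the curve
  have hT : ∀ ψ : ℝ, (⟨circleDiagonal 2 ![(fun i => z₀ i * Circle.exp (![(1 : ℝ), 0, -1] i * ψ)) 0, (fun i => z₀ i * Circle.exp (![(1 : ℝ), 0, -1] i * ψ)) 2], (circleDiagonal_blocks_mem L α w (fun i => z₀ i * Circle.exp (![(1 : ℝ), 0, -1] i * ψ))).1⟩ : unitaryGroupOfForm (starRingEnd ℂ) ((Matrix.diagonal ![α 0, α 2]).map w.1.embedding)) =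
      (⟨circleDiagonal 2 ![z₀ 0 * Circle.exp ψ, z₀ 0 * Circle.exp (-ψ)], circleDiagonal_mem_archLocal_diagonal L 2 ![α 0, α 2] w _⟩ : unitaryGroupOfForm (starRingEnd ℂ) ((Matrix.diagonal ![α 0, α 2]).map w.1.embedding)) := fun ψ => by
    apply Subtype.ext
    show circleDiagonal 2 _ = circleDiagonal 2 _
    congr 1
    funext i; fin_cases i
    · exact hz0 ψ
    · exact hz2 ψ
  have hD : ∀ ψ : ℝ, ((circleDiagonal 1 ![(fun i => z₀ i * Circle.exp (![(1 : ℝ), 0, -1] i * ψ)) 1] : GL (Fin 1) ℂ) : Matrix (Fin 1) (Fin 1) ℂ) = ((circleDiagonal 1 ![z₀ 1] : GL (Fin 1) ℂ) : Matrix (Fin 1) (Fin 1) ℂ) := fun ψ => by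
    rw [hz1]
  -- THE IDENTITY on `0 < |ψ| < δ`: `2 sin ψ · F_Θ(z_ψ) = c₀ · [2 sin ψ · Orb_{G₂}(f♭)(ψ)]`
  have hId : ∀ ψ : ℝ, ψ ≠ 0 → |ψ| < δ →
      (2 * Real.sin ψ : ℂ) * ∫ g, Θ' (((g * ⟨circleDiagonal 3 (fun i => z₀ i * Circle.exp (![(1 : ℝ), 0, -1] i * ψ)), circleDiagonal_mem_archLocal_diagonal L 3 α w _⟩ * g⁻¹ : archLocal L 3 (Matrix.diagonal α) w) : GL (Fin 3) ℂ) : Matrix (Fin 3) (Fin 3) ℂ) ∂ν =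
      (c₀ : ℂ) * ((2 * Real.sin ψ) • ∫ h : unitaryGroupOfForm (starRingEnd ℂ) ((Matrix.diagonal ![α 0, α 2]).map w.1.embedding), (fun X : Matrix (Fin 2) (Fin 2) ℂ => ∫ g, (β g : ℂ) * Θ' (((g : GL (Fin 3) ℂ) : Matrix (Fin 3) (Fin 3) ℂ) * endoForm X ((circleDiagonal 1 ![z₀ 1] : GL (Fin 1) ℂ) : Matrix (Fin 1) (Fin 1) ℂ) * (((g : GL (Fin 3) ℂ)⁻¹ : GL (Fin 3) ℂ) : Matrix (Fin 3) (Fin 3) ℂ)) ∂ν)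
        (((h * (⟨circleDiagonal 2 ![z₀ 0 * Circle.exp ψ, z₀ 0 * Circle.exp (-ψ)], circleDiagonal_mem_archLocal_diagonal L 2 ![α 0, α 2] w _⟩ : unitaryGroupOfForm (starRingEnd ℂ) ((Matrix.diagonal ![α 0, α 2]).map w.1.embedding)) * h⁻¹ : unitaryGroupOfForm (starRingEnd ℂ) ((Matrix.diagonal ![α 0, α 2]).map w.1.embedding)) : GL (Fin 2) ℂ) : Matrix (Fin 2) (Fin 2) ℂ) ∂μ₂) := fun ψ hψ0 hψ => by
    rw [hB β hβ hβs _ (hreg ψ hψ0 hψ) Θ' hΘ'c hΘ'k (h1 ψ hψ.le)]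
    simp only [hT ψ, hD ψ, Complex.real_smul]
    push_cast
    ring
  -- hence the derivatives agree on the punctured neighbourhood
  have hderiv : ∀ᶠ ψ in 𝓝[≠] (0 : ℝ),
      deriv (fun ψ : ℝ => (2 * Real.sin ψ : ℂ) * ∫ g, Θ' (((g * ⟨circleDiagonal 3 (fun i => z₀ i * Circle.exp (![(1 : ℝ), 0, -1] i * ψ)), circleDiagonal_mem_archLocal_diagonal L 3 α w _⟩ * g⁻¹ : archLocal L 3 (Matrix.diagonal α) w) : GL (Fin 3) ℂ) : Matrix (Fin 3) (Fin 3) ℂ) ∂ν) ψ =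
      (c₀ : ℂ) * deriv (fun ψ : ℝ => (2 * Real.sin ψ) • ∫ h : unitaryGroupOfForm (starRingEnd ℂ) ((Matrix.diagonal ![α 0, α 2]).map w.1.embedding), (fun X : Matrix (Fin 2) (Fin 2) ℂ => ∫ g, (β g : ℂ) * Θ' (((g : GL (Fin 3) ℂ) : Matrix (Fin 3) (Fin 3) ℂ) * endoForm X ((circleDiagonal 1 ![z₀ 1] : GL (Fin 1) ℂ) : Matrix (Fin 1) (Fin 1) ℂ) * (((g : GL (Fin 3) ℂ)⁻¹ : GL (Fin 3) ℂ) : Matrix (Fin 3) (Fin 3) ℂ)) ∂ν)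
        (((h * (⟨circleDiagonal 2 ![z₀ 0 * Circle.exp ψ, z₀ 0 * Circle.exp (-ψ)], circleDiagonal_mem_archLocal_diagonal L 2 ![α 0, α 2] w _⟩ : unitaryGroupOfForm (starRingEnd ℂ) ((Matrix.diagonal ![α 0, α 2]).map w.1.embedding)) * h⁻¹ : unitaryGroupOfForm (starRingEnd ℂ) ((Matrix.diagonal ![α 0, α 2]).map w.1.embedding)) : GL (Fin 2) ℂ) : Matrix (Fin 2) (Fin 2) ℂ) ∂μ₂) ψ := by
    rw [eventually_nhdsWithin_iff, Metric.eventually_nhds_iff]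
    refine ⟨δ, hδ, fun ψ hψ hψ0 => ?_⟩
    have hψ' : |ψ| < δ := by simpa [Real.dist_eq] using hψ
    have hψ0' : ψ ≠ 0 := hψ0
    -- the two functions agree on the open set `ball 0 δ ∖ {0}` ∋ ψ
    have hEq : (fun ψ : ℝ => (2 * Real.sin ψ : ℂ) * ∫ g, Θ' (((g * ⟨circleDiagonal 3 (fun i => z₀ i * Circle.exp (![(1 : ℝ), 0, -1] i * ψ)), circleDiagonal_mem_archLocal_diagonal L 3 α w _⟩ * g⁻¹ : archLocal L 3 (Matrix.diagonal α) w) : GL (Fin 3) ℂ) : Matrix (Fin 3) (Fin 3) ℂ) ∂ν) =ᶠ[𝓝 ψ]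
        fun ψ : ℝ => (c₀ : ℂ) * ((2 * Real.sin ψ) • ∫ h : unitaryGroupOfForm (starRingEnd ℂ) ((Matrix.diagonal ![α 0, α 2]).map w.1.embedding), (fun X : Matrix (Fin 2) (Fin 2) ℂ => ∫ g, (β g : ℂ) * Θ' (((g : GL (Fin 3) ℂ) : Matrix (Fin 3) (Fin 3) ℂ) * endoForm X ((circleDiagonal 1 ![z₀ 1] : GL (Fin 1) ℂ) : Matrix (Fin 1) (Fin 1) ℂ) * (((g : GL (Fin 3) ℂ)⁻¹ : GL (Fin 3) ℂ) : Matrix (Fin 3) (Fin 3) ℂ)) ∂ν)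
          (((h * (⟨circleDiagonal 2 ![z₀ 0 * Circle.exp ψ, z₀ 0 * Circle.exp (-ψ)], circleDiagonal_mem_archLocal_diagonal L 2 ![α 0, α 2] w _⟩ : unitaryGroupOfForm (starRingEnd ℂ) ((Matrix.diagonal ![α 0, α 2]).map w.1.embedding)) * h⁻¹ : unitaryGroupOfForm (starRingEnd ℂ) ((Matrix.diagonal ![α 0, α 2]).map w.1.embedding)) : GL (Fin 2) ℂ) : Matrix (Fin 2) (Fin 2) ℂ) ∂μ₂) := by
      have hmem : Metric.ball (0 : ℝ) δ ∩ {(0 : ℝ)}ᶜ ∈ 𝓝 ψ :=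
        (Metric.isOpen_ball.inter isOpen_compl_singleton).mem_nhds ⟨hψ, hψ0'⟩
      filter_upwards [hmem] with ψ' hψ'
      exact hId ψ' hψ'.2 (by simpa [Real.dist_eq] using (Metric.mem_ball.mp hψ'.1))
    rw [hEq.deriv_eq]
    exact deriv_const_mul (c₀ : ℂ) (hdiff ψ ⟨by linarith [(abs_lt.mp (hδ1 ψ hψ')).1], (abs_lt.mp (hδ1 ψ hψ')).2⟩ hψ0')
  -- the singular side: `f♭(z₀(0)·1) = ∫ descConj (t_w z₀) Θ d(ν∕ν_H)` (★ (d3a))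
  have hsing : ∫ y, descConj (⟨circleDiagonal 3 z₀, circleDiagonal_mem_archLocal_diagonal L 3 α w z₀⟩ : archLocal L 3 (Matrix.diagonal α) w)
        (Subgroup.centralizer ({(⟨circleDiagonal 3 z₁, circleDiagonal_mem_archLocal_diagonal L 3 α w z₁⟩ : archLocal L 3 (Matrix.diagonal α) w)} : Set (archLocal L 3 (Matrix.diagonal α) w))) (forall_mem_centralizer_circleDiagonal_comm_of_wall L α w h02 h01 h02' h01')
        (fun k : archLocal L 3 (Matrix.diagonal α) w => Θ' ((k : GL (Fin 3) ℂ) : Matrix (Fin 3) (Fin 3) ℂ)) y ∂(quotientMeasure _ νH (isClosed_coe_centralizer_singleton _) ν) =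
      (fun X : Matrix (Fin 2) (Fin 2) ℂ => ∫ g, (β g : ℂ) * Θ' (((g : GL (Fin 3) ℂ) : Matrix (Fin 3) (Fin 3) ℂ) * endoForm X ((circleDiagonal 1 ![z₀ 1] : GL (Fin 1) ℂ) : Matrix (Fin 1) (Fin 1) ℂ) * (((g : GL (Fin 3) ℂ)⁻¹ : GL (Fin 3) ℂ) : Matrix (Fin 3) (Fin 3) ℂ)) ∂ν) (((z₀ 0 : Circle) : ℂ) • (1 : Matrix (Fin 2) (Fin 2) ℂ)) := by
    have h10 : ∀ g : archLocal L 3 (Matrix.diagonal α) w, Θ' (((g * (⟨circleDiagonal 3 z₀, circleDiagonal_mem_archLocal_diagonal L 3 α w z₀⟩ : archLocal L 3 (Matrix.diagonal α) w) * g⁻¹ : archLocal L 3 (Matrix.diagonal α) w) : GL (Fin 3) ℂ) : Matrix (Fin 3) (Fin 3) ℂ) ≠ 0 → ∫ h : Subgroup.centralizer ({(⟨circleDiagonal 3 z₁, circleDiagonal_mem_archLocal_diagonal L 3 α w z₁⟩ : archLocal L 3 (Matrix.diagonal α) w)} : Set (archLocal L 3 (Matrix.diagonal α) w)), β (g * h)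 ∂νH = 1 := by
      have h := h1 0 (by simpa using hδ.le)
      simpa [Circle.exp_zero] using h
    exact integral_descConj_wall_eq_integral_mul_averaged L α w _ h02' νH ν β hβ hβs Θ' hΘ'c h10
  -- conclude
  have hval : ((c₀ * C : ℝ) : ℂ) * ∫ y, descConj (⟨circleDiagonal 3 z₀, circleDiagonal_mem_archLocal_diagonal L 3 α w z₀⟩ : archLocal L 3 (Matrix.diagonal α) w)
        (Subgroup.centralizer ({(⟨circleDiagonal 3 z₁, circleDiagonal_mem_archLocal_diagonal L 3 α w z₁⟩ : archLocal L 3 (Matrix.diagonal α) w)} : Set (archLocal L 3 (Matrix.diagonal α) w))) (forall_mem_centralizer_circleDiagonal_comm_of_wall L α w h02 h01 h02' h01')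
        (fun k : archLocal L 3 (Matrix.diagonal α) w => Θ' ((k : GL (Fin 3) ℂ) : Matrix (Fin 3) (Fin 3) ℂ)) y ∂(quotientMeasure _ νH (isClosed_coe_centralizer_singleton _) ν) =
      (c₀ : ℂ) * (C • (fun X : Matrix (Fin 2) (Fin 2) ℂ => ∫ g, (β g : ℂ) * Θ' (((g : GL (Fin 3) ℂ) : Matrix (Fin 3) (Fin 3) ℂ) * endoForm X ((circleDiagonal 1 ![z₀ 1] : GL (Fin 1) ℂ) : Matrix (Fin 1) (Fin 1) ℂ) * (((g : GL (Fin 3) ℂ)⁻¹ : GL (Fin 3) ℂ) : Matrix (Fin 3) (Fin 3) ℂ)) ∂ν) (((z₀ 0 : Circle) : ℂ) • (1 : Matrix (Fin 2) (Fin 2) ℂ))) := by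
    rw [hsing, Complex.real_smul, Complex.ofReal_mul, mul_assoc]
  rw [hval]
  exact (hlim.const_mul (c₀ : ℂ)).congr' (hderiv.mono fun ψ h => h.symm)

end Literature.NumberTheory.Rogawski1990

end
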